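import Literature.Probability.LatticeModels.ReflectionPositivity
import Mathlib.MeasureTheory.Integral.IntegrableOn
import Mathlib.Algebra.QuadraticDiscriminant
import HarnessLib

/-!
# The two half-tori of a reflection through sites meet in the plane `P`
(discharge of `Torus.reflectThroughSites_image_half_inter`)

This file discharges the named fact
`Literature.Probability.LatticeModels.Torus.reflectThroughSites_image_half_inter` of
`Literature/Probability/LatticeModels/ReflectionPositivity.lean`.

Biskup 2009 §5.1 (first two paragraphs): on the torus `𝕋_L` with `L` even, the plane of
reflection `P` "has two components, one at the front of the torus and the other at the back",
and the two halves `𝕋_L^+`, `𝕋_L^-` obey `𝕋_L^+ ∩ 𝕋_L^- = P` for reflections through sites.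
With `θ = reflectThroughSites i k` (`x_i ↦ 2k - x_i`), `𝕋_L^+ = halfThroughSites i k`
(`(x_i - k).val ≤ L/2`) and `𝕋_L^- = θ(𝕋_L^+)`, this is the identity
`θ '' 𝕋_L^+ ∩ 𝕋_L^+ = {x | x_i = k ∨ x_i = k + L/2}`.

## Proof

Elementary `ZMod L` arithmetic. `θ` is an involution, so `θ '' 𝕋_L^+ = θ ⁻¹' 𝕋_L^+`; with
`a = x_i - k` one has `(θx)_i - k = -a`, so membership in both halves reads
`(-a).val ≤ L/2 ∧ a.val ≤ L/2`, and for `L = m + m` (using `ZMod.neg_val`: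
`(-a).val = L - a.val` for `a ≠ 0`) this holds iff `a.val ∈ {0, m}`, i.e. iff `a = 0 ∨ a = L/2`.

## References

* M. Biskup, *Reflection positivity and phase transitions in lattice spin models*, in: Methods of
  Contemporary Mathematical Statistical Physics, Lecture Notes in Math. 1970, Springer (2009),
  1–86, §5.1; arXiv:math-ph/0610025. [Biskup2009]
* J. Fröhlich, R. Israel, E. H. Lieb, B. Simon, *Phase transitions and reflection positivity I*,
  Comm. Math. Phys. 62 (1978), §2. [FILS1978]

# Part II. Discharge of the RP Cauchy–Schwarz inequality `rp_cauchySchwarz`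

The second part of this sibling proof file (appended; the first part above is unchanged)
discharges the named fact

* `Literature.Probability.LatticeModels.rp_cauchySchwarz` — for a finite measure `μ` on
  configurations `V → S` that is reflection positive (`IsReflectionPositive μ θ V₊`) and
  reflection invariant (`IsReflectionInvariant μ θ`) along an involution `θ`, and bounded
  `positiveEvents V₊`-measurable `F, G : (V → S) → ℂ`,
  `|∫ conj (F ∘ θ) G dμ|² ≤ (Re ∫ conj (F ∘ θ) F dμ) (Re ∫ conj (G ∘ θ) G dμ)`,

as `rp_cauchySchwarz_holds`.

Source and proof architecture. This is the Schwarz inequality of a reflection-positive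
functional, J. Fröhlich, R. Israel, E. H. Lieb, B. Simon, *Phase transitions and reflection
positivity. I*, Comm. Math. Phys. **62** (1978) 1–34, §2, proof of Thm. 2.3 ("Since `⟨·⟩₀` is RP,
we have a Schwarz inequality `|⟨A θB⟩₀|² ≤ ⟨A θA⟩₀ ⟨B θB⟩₀`"); M. Biskup, *Reflection positivity
and phase transitions in lattice spin models*, LNM 1970 (2009), §5.1, the display
`[E_μ(f ϑg)]² ≤ E_μ(f ϑf) E_μ(g ϑg)` following Def. 5.2 ("a fundamental consequence of reflection
positivity is the Cauchy–Schwarz inequality"). The printed proofs are the one-line appeal to the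
Cauchy–Schwarz inequality for the positive semidefinite (sesqui/bi)linear form
`B(f, g) = ∫ conj (f ∘ θ) · g dμ`; Biskup's Def. 5.2 builds the symmetry `B(f, g) = B(g, f)` into
the definition of RP and remarks that it "requires only ϑ-invariance of μ". Here we spell this
out: (1) the four products `conj (f ∘ θ) · g` are integrable (bounded, measurable, finite
measure: `integrable_conj_comp_mul`); (2) reflection invariance + `θ² = id` give the Hermitian
symmetry `B(g, f) = conj B(f, g)` (`integral_conj_comp_mul_swap`, change of variables
`MeasureTheory.integral_map` + `integral_conj`); (3) RP applied to `F + λ G` with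
`λ = -t · conj B(F, G)`, `t ∈ ℝ`, expands (`integral_rpForm_add_mul`) to the real quadratic
`0 ≤ a - 2t|z|² + t²|z|²c` (`a = Re B(F,F)`, `c = Re B(G,G)`, `z = B(F,G)`), whose discriminant
is therefore `≤ 0` (`discrim_le_zero`), i.e. `|z|⁴ ≤ |z|² a c`, whence `|z|² ≤ a c` (the case
`z = 0` by `a, c ≥ 0`, which is RP for `F` and for `G`).

No new definitions and no new named facts are introduced here.
-/

namespace Literature.Probability.LatticeModels.Torus

variable {d L : ℕ}

/-- The reflection through sites is its own inverse as an `Equiv`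
(Biskup 2009 §5.1, `θ² = id`). [cite: Biskup2009, §5.1] -/
@[simp]
theorem reflectThroughSites_symm (i : Fin d) (k : ZMod L) :
    (reflectThroughSites (d := d) (L := L) i k).symm = reflectThroughSites i k := rfl

/-- The reflection between sites is its own inverse as an `Equiv`
(Biskup 2009 §5.1, `θ² = id`). [cite: Biskup2009, §5.1] -/
@[simp]
theorem reflectBetweenSites_symm (i : Fin d) (k : ZMod L) :
    (reflectBetweenSites (d := d) (L := L) i k).symm = reflectBetweenSites i k := rfl

variable [NeZero L]

/-- Arithmetic core of `𝕋_L^+ ∩ 𝕋_L^- = P` (Biskup 2009 §5.1): for `L = m + m` and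
`a : ZMod L` (the signed distance `x_i - k` to the plane), both `a` and `-a` have representative
`≤ L/2` iff `a = 0` or `a = L/2`. [cite: Biskup2009, §5.1] -/
private theorem neg_val_le_half_and_val_le_half_iff {m : ℕ} (hL : L = m + m) (a : ZMod L) :
    ((-a).val ≤ L / 2 ∧ a.val ≤ L / 2) ↔ (a = 0 ∨ a = ((L / 2 : ℕ) : ZMod L)) := by
  have hL0 : 0 < L := Nat.pos_of_ne_zero (NeZero.ne L)
  have hLm : L / 2 = m := by omega
  have hmL : m < L := by omega
  have hval : ((m : ℕ) : ZMod L).val = m := ZMod.val_cast_of_lt hmL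
  rw [hLm, ZMod.neg_val]
  by_cases ha : a = 0
  · subst ha
    simp
  · rw [if_neg ha]
    have hlt : a.val < L := ZMod.val_lt a
    constructor
    · rintro ⟨h1, h2⟩
      refine Or.inr (ZMod.val_injective L ?_)
      rw [hval]
      omega
    · rintro (h | h)
      · exact absurd h ha
      · subst h
        rw [hval]
        omega

/-- **Discharge of `reflectThroughSites_image_half_inter`** (Biskup 2009 §5.1: for reflections
through sites the two halves of the torus obey `𝕋_L^+ ∩ 𝕋_L^- = P`, where `𝕋_L^- = θ(𝕋_L^+)`
and the plane of reflection `P` has the two components `x_i = k` (front) and `x_i = k + L/2`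
(back)). Proof: `θ` is an involution, so `θ '' 𝕋_L^+ = θ ⁻¹' 𝕋_L^+`; with `a = x_i - k` we have
`(θx)_i - k = -a`, so membership in both halves reads `(-a).val ≤ L/2 ∧ a.val ≤ L/2`, which for
even `L` holds iff `a = 0 ∨ a = L/2`. [cite: Biskup2009, §5.1] -/
theorem reflectThroughSites_image_half_inter_holds :
    reflectThroughSites_image_half_inter (d := d) (L := L) := by
  intro hL i k
  obtain ⟨m, hm⟩ := hL
  ext x
  rw [Equiv.image_eq_preimage_symm, reflectThroughSites_symm]
  simp only [Set.mem_inter_iff, Set.mem_preimage, halfThroughSites, Set.mem_setOf_eq,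
    reflectThroughSites_apply, Function.update_self]
  have h2 : 2 * k - x i - k = -(x i - k) := by ring
  rw [h2, neg_val_le_half_and_val_le_half_iff hm (x i - k), sub_eq_zero, sub_eq_iff_eq_add']

end Literature.Probability.LatticeModels.Torus

/-! ## Part II: the Cauchy–Schwarz inequality of reflection positivity -/

open MeasureTheory
open scoped ComplexConjugate

namespace Literature.Probability.LatticeModels

section Config

variable {V S : Type*} [MeasurableSpace S]

/-- For `positiveEvents V₊`-measurable `f, g : (V → S) → ℂ`, the RP integrand
`σ ↦ conj (f (θσ)) · g σ` is measurable for the product σ-algebra (the positive-half σ-algebra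
is coarser than the product one, `MeasureTheory.cylinderEvents_le_pi`, and `σ ↦ θσ` is a
coordinate permutation). Routine measure theory behind FILS 1978 §2. [folklore] -/
theorem measurable_conj_comp_mul (θ : V ≃ V) {Vpos : Set V} {f g : (V → S) → ℂ}
    (hf : Measurable[positiveEvents Vpos] f) (hg : Measurable[positiveEvents Vpos] g) :
    Measurable fun σ' => conj (f (configReflect θ σ')) * g σ' := by
  have hf' : Measurable f := hf.mono cylinderEvents_le_pi le_rfl
  have hg' : Measurable g := hg.mono cylinderEvents_le_pi le_rfl
  exact ((Complex.continuous_conj.measurable.comp hf').comp (measurable_configReflect θ)).mul hg'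

/-- For bounded `positiveEvents V₊`-measurable `f, g : (V → S) → ℂ` and a finite measure `μ`, the
RP integrand `σ ↦ conj (f (θσ)) · g σ` is `μ`-integrable (bounded by the product of the bounds).
Routine measure theory behind FILS 1978 §2. [folklore] -/
theorem integrable_conj_comp_mul {μ : Measure (V → S)} [IsFiniteMeasure μ] (θ : V ≃ V)
    {Vpos : Set V} {f g : (V → S) → ℂ}
    (hf : Measurable[positiveEvents Vpos] f) (hfb : ∃ C, ∀ σ', ‖f σ'‖ ≤ C)
    (hg : Measurable[positiveEvents Vpos] g) (hgb : ∃ C, ∀ σ', ‖g σ'‖ ≤ C) :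
    Integrable (fun σ' => conj (f (configReflect θ σ')) * g σ') μ := by
  obtain ⟨Cf, hCf⟩ := hfb
  obtain ⟨Cg, hCg⟩ := hgb
  refine Integrable.of_bound (measurable_conj_comp_mul θ hf hg).aestronglyMeasurable (Cf * Cg)
    (ae_of_all _ fun σ' => ?_)
  rw [norm_mul, Complex.norm_conj]
  exact mul_le_mul (hCf _) (hCg _) (norm_nonneg _)
    ((norm_nonneg (f (configReflect θ σ'))).trans (hCf _))

/-- **Hermitian symmetry of the RP form.** If `μ` is invariant under the configuration
reflection along an involution `θ`, then `∫ conj (g ∘ θ) f dμ = conj (∫ conj (f ∘ θ) g dμ)` for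
`positiveEvents V₊`-measurable `f, g` (change of variables `σ ↦ θσ`, then `θ² = id`). This is the
symmetry condition (1) of Biskup 2009 Def. 5.2, which "requires only ϑ-invariance of μ"
(Biskup 2009, remark after Def. 5.2). [cite: Biskup2009, §5.1 remark after Def. 5.2] -/
theorem integral_conj_comp_mul_swap {μ : Measure (V → S)} {θ : V ≃ V}
    (hθ : Function.Involutive θ) (hinv : IsReflectionInvariant μ θ) {Vpos : Set V}
    {f g : (V → S) → ℂ}
    (hf : Measurable[positiveEvents Vpos] f) (hg : Measurable[positiveEvents Vpos] g) :
    ∫ σ', conj (g (configReflect θ σ')) * f σ' ∂μ =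
      conj (∫ σ', conj (f (configReflect θ σ')) * g σ' ∂μ) := by
  have hmeas := measurable_conj_comp_mul θ hg hf
  have hmap : μ.map (configReflect θ) = μ := hinv
  have h1 : ∫ σ', conj (g (configReflect θ σ')) * f σ' ∂μ =
      ∫ σ', conj (g (configReflect θ (configReflect θ σ'))) * f (configReflect θ σ') ∂μ := by
    conv_lhs => rw [← hmap]
    exact integral_map (measurable_configReflect θ).aemeasurable hmeas.aestronglyMeasurable
  rw [h1, ← integral_conj]
  refine integral_congr_ae (ae_of_all _ fun σ' => ?_)
  simp only [configReflect_configReflect_of_involutive hθ, map_mul, Complex.conj_conj]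
  exact mul_comm _ _

/-- **Expansion of the RP form on `F + λ G`.** For bounded `positiveEvents V₊`-measurable `F, G`
and `λ ∈ ℂ`, with `B(f, g) = ∫ conj (f ∘ θ) g dμ`:
`B(F + λG, F + λG) = B(F,F) + λ B(F,G) + conj λ · B(G,F) + conj λ · λ · B(G,G)`
(sesquilinearity; linearity of the Bochner integral on the four integrable products). The
algebra behind the Schwarz inequality of FILS 1978 §2. [folklore] -/
theorem integral_rpForm_add_mul {μ : Measure (V → S)} [IsFiniteMeasure μ] (θ : V ≃ V)
    {Vpos : Set V} {F G : (V → S) → ℂ}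
    (hF : Measurable[positiveEvents Vpos] F) (hFb : ∃ C, ∀ σ', ‖F σ'‖ ≤ C)
    (hG : Measurable[positiveEvents Vpos] G) (hGb : ∃ C, ∀ σ', ‖G σ'‖ ≤ C) (lam : ℂ) :
    ∫ σ', conj (F (configReflect θ σ') + lam * G (configReflect θ σ')) *
        (F σ' + lam * G σ') ∂μ =
      (∫ σ', conj (F (configReflect θ σ')) * F σ' ∂μ) +
        lam * (∫ σ', conj (F (configReflect θ σ')) * G σ' ∂μ) +
        conj lam * (∫ σ', conj (G (configReflect θ σ')) * F σ' ∂μ) +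
        conj lam * lam * (∫ σ', conj (G (configReflect θ σ')) * G σ' ∂μ) := by
  have hFF := integrable_conj_comp_mul (μ := μ) θ hF hFb hF hFb
  have hFG := integrable_conj_comp_mul (μ := μ) θ hF hFb hG hGb
  have hGF := integrable_conj_comp_mul (μ := μ) θ hG hGb hF hFb
  have hGG := integrable_conj_comp_mul (μ := μ) θ hG hGb hG hGb
  have hpt : (fun σ' => conj (F (configReflect θ σ') + lam * G (configReflect θ σ')) *
      (F σ' + lam * G σ')) =
      fun σ' => (conj (F (configReflect θ σ')) * F σ' +
        lam * (conj (F (configReflect θ σ')) * G σ')) +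
        (conj lam * (conj (G (configReflect θ σ')) * F σ') +
          conj lam * lam * (conj (G (configReflect θ σ')) * G σ')) := by
    funext σ'
    simp only [map_add, map_mul]
    ring
  rw [hpt, integral_add (hFF.fun_add (hFG.const_mul lam))
      ((hGF.const_mul (conj lam)).fun_add (hGG.const_mul (conj lam * lam))),
    integral_add hFF (hFG.const_mul lam),
    integral_add (hGF.const_mul (conj lam)) (hGG.const_mul (conj lam * lam)),
    integral_const_mul, integral_const_mul, integral_const_mul]
  ring

/-- Discharge of the named fact `rp_cauchySchwarz`: the **Cauchy–Schwarz inequality of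
reflection positivity**. If the finite measure `μ` on `V → S` is reflection positive w.r.t.
`(θ, V₊)` and reflection invariant along the involution `θ`, then for bounded
`positiveEvents V₊`-measurable `F, G : (V → S) → ℂ`,
`|∫ conj (F ∘ θ) G dμ|² ≤ (Re ∫ conj (F ∘ θ) F dμ) · (Re ∫ conj (G ∘ θ) G dμ)`.
This is the Schwarz inequality `|⟨A θB⟩₀|² ≤ ⟨A θA⟩₀⟨B θB⟩₀` of a reflection-positive functional,
FILS 1978 §2, proof of Thm. 2.3 (the docstring of `rp_cauchySchwarz` says "Thm. 2.1 proof"; in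
CMP 62 the inequality is invoked in the proof of Thm. 2.3), and Biskup 2009 §5.1, the display
after Def. 5.2. Proof: Hermitian symmetry of `B(f,g) = ∫ conj (f∘θ) g dμ` from invariance
(`integral_conj_comp_mul_swap`), RP on `F + λG` with `λ = -t · conj B(F,G)` (`t ∈ ℝ`) gives the
everywhere-nonnegative real quadratic `a - 2t|z|² + t²|z|²c`, so its discriminant is `≤ 0`
(`discrim_le_zero`), i.e. `|z|² ≤ a c`. [cite: FILS1978, §2 proof of Thm. 2.3] -/
theorem rp_cauchySchwarz_holds : rp_cauchySchwarz (V := V) (S := S) := by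
  intro μ _ θ Vpos hθ hμ hinv F G hF hFb hG hGb
  -- the three numbers of the statement
  set z : ℂ := ∫ σ', conj (F (configReflect θ σ')) * G σ' ∂μ with hz
  set P : ℂ := ∫ σ', conj (F (configReflect θ σ')) * F σ' ∂μ with hP
  set Q : ℂ := ∫ σ', conj (G (configReflect θ σ')) * G σ' ∂μ with hQ
  have ha0 : 0 ≤ P.re := hμ F hF hFb
  have hc0 : 0 ≤ Q.re := hμ G hG hGb
  -- Hermitian symmetry from reflection invariance
  have hherm : ∫ σ', conj (G (configReflect θ σ')) * F σ' ∂μ = conj z :=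
    integral_conj_comp_mul_swap hθ hinv hF hG
  have hzz : conj z * z = (‖z‖ : ℂ) ^ 2 := Complex.conj_mul' z
  -- RP applied to `F + λ G`, `λ = -t conj z`: a nonnegative real quadratic in `t`
  have hquad : ∀ t : ℝ, 0 ≤ ‖z‖ ^ 2 * Q.re * (t * t) + -(2 * ‖z‖ ^ 2) * t + P.re := by
    intro t
    set lam : ℂ := -((t : ℂ) * conj z) with hlam
    have hH : Measurable[positiveEvents Vpos] fun σ' => F σ' + lam * G σ' :=
      hF.add (hG.const_mul lam)
    have hHb : ∃ C, ∀ σ', ‖F σ' + lam * G σ'‖ ≤ C := by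
      obtain ⟨CF, hCF⟩ := hFb
      obtain ⟨CG, hCG⟩ := hGb
      refine ⟨CF + ‖lam‖ * CG, fun σ' => (norm_add_le _ _).trans (add_le_add (hCF σ') ?_)⟩
      rw [norm_mul]
      exact mul_le_mul_of_nonneg_left (hCG σ') (norm_nonneg _)
    have hpos : 0 ≤ (∫ σ', conj (F (configReflect θ σ') + lam * G (configReflect θ σ')) *
        (F σ' + lam * G σ') ∂μ).re := hμ _ hH hHb
    have hval : ∫ σ', conj (F (configReflect θ σ') + lam * G (configReflect θ σ')) *
        (F σ' + lam * G σ') ∂μ =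
        P + ((-(2 * t * ‖z‖ ^ 2) : ℝ) : ℂ) + ((t * t * ‖z‖ ^ 2 : ℝ) : ℂ) * Q := by
      rw [integral_rpForm_add_mul θ hF hFb hG hGb lam, hherm]
      simp only [hlam, map_neg, map_mul, Complex.conj_ofReal, Complex.conj_conj]
      push_cast
      linear_combination (-(t : ℂ) - t + t * t * Q) * hzz
    have hre : (∫ σ', conj (F (configReflect θ σ') + lam * G (configReflect θ σ')) *
        (F σ' + lam * G σ') ∂μ).re = P.re + -(2 * t * ‖z‖ ^ 2) + t * t * ‖z‖ ^ 2 * Q.re := by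
      rw [hval]
      simp only [Complex.add_re, Complex.ofReal_re, Complex.re_ofReal_mul]
    rw [hre] at hpos
    convert hpos using 1
    ring
  -- discriminant ≤ 0, i.e. `|z|⁴ ≤ |z|² a c`
  have hdisc := discrim_le_zero hquad
  rw [discrim] at hdisc
  have hq0 : 0 ≤ ‖z‖ ^ 2 := by positivity
  have hqq : ‖z‖ ^ 2 * ‖z‖ ^ 2 ≤ ‖z‖ ^ 2 * (P.re * Q.re) := by nlinarith [hdisc]
  rcases hq0.eq_or_lt with h | h
  · rw [← h]; exact mul_nonneg ha0 hc0
  · exact le_of_mul_le_mul_left hqq h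

end Config

end Literature.Probability.LatticeModels
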